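import Literature.Computability.AlgebraicComplexity.AndrewsForbes2022DeterminantalIdeals
import Literature.Barriers.ValiantsHypothesis.PartialDerivativesDetPerm
import Mathlib.Data.Nat.Choose.Vandermonde
import HarnessLib

/-!
# Discharge of `AndrewsForbes2022_dim_partialSpace_det`: `dim ∂_{<∞}(det_r) = binom(2r, r)`
(cell val-lit, seat t22 on discharge duty; fact typed by t24 in
`AndrewsForbes2022DeterminantalIdeals.lean`)

R. Andrews, M. A. Forbes, *Ideals, determinants, and straightening: proving and using lower bounds
for polynomial ideals*, STOC 2022 / arXiv:2112.00792, §5 (p. 29): "Since `det_r(X) ∈ I^det_{n,m,r}` and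
`dim(∂_{<∞}(det_r)) = binom(2r, r)`" — the value printed in Thm. 5.4. HONEST FRAMING: classical linear
algebra (the partial derivatives of the determinant span the minors); nothing here bears on
`VP ≠ VNP` beyond discharging a typed literature fact.

## Proof (the classical one)

* The Hasse derivative `∂/∂x^a` (AF22 Def. 2.13 / Lemma 2.14, tree `mvHasseDeriv`) of a MULTILINEAR
  polynomial is the iterated partial derivative along the variables of `a` when `a` is square-free,
  and `0` otherwise (`mvHasseDeriv_monomial_sqfree`, `mvHasseDeriv_permSum_of_nodup`,
  `mvHasseDeriv_permSum_eq_zero`); we first record `∂/∂x^a` coefficient-wise (`coeff_mvHasseDeriv`),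
  which makes it additive (`mvHasseDeriv_sum`).
* Hence `∂_{<∞}(det_n)` (tree `partialSpace`) is the span of ALL iterated partial derivatives of the
  permutation sum `det_n = ∑_π sgn(π) ∏ x_{π i, i}` (tree `permSum`, `detPoly_eq_permSum`), i.e. of the
  canonical derivatives = signed minors of all orders (tree `gen`, `span_derivSet_permSum`,
  `Literature/Barriers/ValiantsHypothesis/PartialDerivativesDetPerm.lean`):
  `partialSpace_permSum_eq_span`.
* The canonical derivatives of all orders `k = 0, …, n` together are linearly independent
  (`linearIndependent_allGen`: within one order by the tree's `coeff_gen_of_ne`, across orders because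
  the leading monomials have different degrees, `coeff_gen_eq_zero_of_card_ne`), and there are
  `∑_k binom(n,k)²` of them; `∑_k binom(n,k)² = binom(2n, n)` is Mathlib's `Nat.sum_range_choose_sq`.
* `finrank_partialSpace_permSum`, `finrank_partialSpace_detPoly`, `finrank_partialSpace_perPoly`, and
  the discharge `AndrewsForbes2022_dim_partialSpace_det_holds`.

## References

* [AndrewsForbes2022] R. Andrews, M. A. Forbes, *Ideals, determinants, and straightening*, STOC 2022;
  arXiv:2112.00792, Thm. 5.4 and §5 (p. 29).
* [LandsbergGCT2017] J. M. Landsberg, *Geometry and complexity theory*, CUP 2017, Exercise 6.2.2.7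
  (the graded pieces, tree `flatteningRank_detPoly`).
-/

noncomputable section

open MvPolynomial Literature.Barriers.ValiantsHypothesis

namespace Literature.Computability.AlgebraicComplexity

/-! ## Hasse derivatives coefficient-wise; multilinear monomials -/

section Hasse

variable {R : Type*} [CommSemiring R] {σ : Type*}

/-- The binomial weight `∏ᵢ binom(bᵢ, aᵢ)` of Lemma 2.14 vanishes unless `a ≤ b`. [cite: AndrewsForbes2022, Lemma 2.14] -/
theorem prod_choose_eq_zero_of_not_le {a b : σ →₀ ℕ} (h : ¬ a ≤ b) :
    (a.prod fun i k => ((b i).choose k : R)) = 0 := by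
  classical
  rw [Finsupp.le_iff] at h
  push Not at h
  obtain ⟨i, hi, hlt⟩ := h
  rw [Finsupp.prod, Finset.prod_eq_zero hi]
  rw [Nat.choose_eq_zero_of_lt hlt, Nat.cast_zero]

/-- **Hasse derivatives coefficient-wise** (from Lemma 2.14): the `x^e`-coefficient of `∂/∂x^a (f)` is
`(∏ᵢ binom(eᵢ + aᵢ, aᵢ)) · coeff_{e + a}(f)`. [cite: AndrewsForbes2022, Lemma 2.14] -/
theorem coeff_mvHasseDeriv (a e : σ →₀ ℕ) (f : MvPolynomial σ R) :
    coeff e (mvHasseDeriv a f) = (a.prod fun i k => (((e + a) i).choose k : R)) * coeff (e + a) f := by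
  classical
  rw [mvHasseDeriv, coeff_sum]
  simp_rw [coeff_monomial]
  rw [Finset.sum_eq_single (e + a)]
  · rw [if_pos (add_tsub_cancel_right e a)]
  · intro b _ hne
    split_ifs with h
    · have hnle : ¬ a ≤ b := fun hle => hne (by rw [← h, tsub_add_cancel_of_le hle])
      rw [prod_choose_eq_zero_of_not_le hnle, zero_mul]
    · rfl
  · intro h
    rw [if_pos (add_tsub_cancel_right e a), MvPolynomial.notMem_support_iff.1 h, mul_zero]

/-- Hasse derivatives are additive over finite sums. [cite: AndrewsForbes2022, Def. 2.13] -/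
theorem mvHasseDeriv_sum {ι : Type*} (a : σ →₀ ℕ) (s : Finset ι) (f : ι → MvPolynomial σ R) :
    mvHasseDeriv a (∑ i ∈ s, f i) = ∑ i ∈ s, mvHasseDeriv a (f i) := by
  ext e
  rw [coeff_mvHasseDeriv, coeff_sum, coeff_sum, Finset.mul_sum]
  exact Finset.sum_congr rfl fun i _ => (coeff_mvHasseDeriv a e (f i)).symm

variable [DecidableEq σ]

/-- `x^A ∣ x^S` for square-free monomials iff `A ⊆ S`. [cite: AndrewsForbes2022, Lemma 2.14 (proof)] -/
theorem sqfree_le_sqfree_iff {A S : Finset σ} : sqfree A ≤ sqfree S ↔ A ⊆ S := by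
  rw [Finsupp.le_def]
  constructor
  · intro h i hi
    have h1 := h i
    rw [sqfree_apply, sqfree_apply, if_pos hi] at h1
    by_contra hiS
    rw [if_neg hiS] at h1
    exact Nat.not_succ_le_zero 0 h1
  · intro h i
    rw [sqfree_apply, sqfree_apply]
    by_cases hi : i ∈ A
    · rw [if_pos hi, if_pos (h hi)]
    · rw [if_neg hi]
      exact Nat.zero_le _

/-- `x^S / x^A = x^{S ∖ A}` (truncated exponent subtraction). [cite: AndrewsForbes2022, Lemma 2.14 (proof)] -/
theorem sqfree_sub_sqfree (A S : Finset σ) : sqfree S - sqfree A = sqfree (S \ A) := by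
  ext i
  rw [Finsupp.tsub_apply, sqfree_apply, sqfree_apply, sqfree_apply]
  by_cases hiS : i ∈ S <;> by_cases hiA : i ∈ A <;> simp [hiS, hiA, Finset.mem_sdiff]

/-- An exponent vector below a square-free one is the square-free vector of its support. [cite: AndrewsForbes2022, Lemma 2.14 (proof)] -/
theorem eq_sqfree_support_of_forall_le_one {a : σ →₀ ℕ} (h : ∀ v, a v ≤ 1) :
    a = sqfree a.support := by
  ext v
  rw [sqfree_apply]
  split_ifs with hv
  · exact le_antisymm (h v) (Nat.one_le_iff_ne_zero.2 (Finsupp.mem_support_iff.1 hv))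
  · exact Finsupp.notMem_support_iff.1 hv

/-- An exponent vector with an entry `≥ 2` is below no square-free vector. [cite: AndrewsForbes2022, Lemma 2.14 (proof)] -/
theorem not_le_sqfree_of_two_le {a : σ →₀ ℕ} {v : σ} (hv : 2 ≤ a v) (S : Finset σ) :
    ¬ a ≤ sqfree S := by
  intro h
  have h1 := Finsupp.le_def.1 h v
  rw [sqfree_apply] at h1
  split_ifs at h1 <;> omega

/-- **Hasse derivative of a square-free monomial** (Lemma 2.14 with all `binom(1, ·)`, `binom(0, ·)`):
`∂/∂x^a (c·x^S) = c·x^S/x^a` if `x^a ∣ x^S`, and `0` otherwise. [cite: AndrewsForbes2022, Lemma 2.14] -/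
theorem mvHasseDeriv_monomial_sqfree (a : σ →₀ ℕ) (S : Finset σ) (c : R) :
    mvHasseDeriv a (monomial (sqfree S) c) =
      if a ≤ sqfree S then monomial (sqfree S - a) c else 0 := by
  rw [mvHasseDeriv_monomial]
  split_ifs with h
  · have hw : (a.prod fun i k => (((sqfree S) i).choose k : R)) = 1 := by
      rw [Finsupp.prod]
      refine Finset.prod_eq_one fun i hi => ?_
      have h1 := Finsupp.le_def.1 h i
      have hpos := Nat.one_le_iff_ne_zero.2 (Finsupp.mem_support_iff.1 hi)
      rw [sqfree_apply] at h1 ⊢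
      split_ifs at h1 ⊢ with hiS
      · have : a i = 1 := le_antisymm h1 hpos
        rw [this, Nat.choose_self, Nat.cast_one]
      · omega
    rw [hw, one_mul]
  · rw [prod_choose_eq_zero_of_not_le h, zero_mul, map_zero]

/-- **Hasse = iterated partial on multilinear monomials:** for distinct variables `l`,
`∂/∂x^{l} (c·x^S) = ∂_{l₁} ⋯ ∂_{l_k} (c·x^S)` (tree `iterPDeriv_monomial_sqfree`). [cite: AndrewsForbes2022, Def. 2.13] -/
theorem mvHasseDeriv_sqfree_monomial_eq_iterPDeriv (l : List σ) (hl : l.Nodup) (S : Finset σ) (c : R) :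
    mvHasseDeriv (sqfree l.toFinset) (monomial (sqfree S) c) = iterPDeriv l (monomial (sqfree S) c) := by
  rw [mvHasseDeriv_monomial_sqfree, iterPDeriv_monomial_sqfree]
  by_cases h : l.toFinset ⊆ S
  · rw [if_pos (sqfree_le_sqfree_iff.2 h), sqfree_sub_sqfree,
      if_pos ⟨hl, fun v hv => h (List.mem_toFinset.2 hv)⟩]
  · rw [if_neg (fun h' => h (sqfree_le_sqfree_iff.1 h')), if_neg]
    rintro ⟨-, h'⟩
    exact h fun v hv => h' v (List.mem_toFinset.1 hv)

end Hasse

/-! ## Hasse derivatives of the permutation sums `det_n`, `perm_n` -/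

section PermSum

variable {K : Type*} [Field K] {n : ℕ}

/-- For distinct variables, the Hasse derivative of a permutation sum is the iterated partial derivative.
[cite: AndrewsForbes2022, Def. 2.13 and §5] -/
theorem mvHasseDeriv_permSum_of_nodup (c : Equiv.Perm (Fin n) → K) (l : List (Fin n × Fin n))
    (hl : l.Nodup) :
    mvHasseDeriv (sqfree l.toFinset) (permSum c) = iterPDeriv l (permSum c) := by
  rw [permSum, mvHasseDeriv_sum, iterPDeriv_sum]
  exact Finset.sum_congr rfl fun π _ => mvHasseDeriv_sqfree_monomial_eq_iterPDeriv l hl _ _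

/-- A Hasse derivative of order `≥ 2` in some variable kills the (multilinear) permutation sum.
[cite: AndrewsForbes2022, Lemma 2.14 and §5] -/
theorem mvHasseDeriv_permSum_eq_zero (c : Equiv.Perm (Fin n) → K) {a : Fin n × Fin n →₀ ℕ}
    {v : Fin n × Fin n} (hv : 2 ≤ a v) : mvHasseDeriv a (permSum c) = 0 := by
  rw [permSum, mvHasseDeriv_sum]
  refine Finset.sum_eq_zero fun π _ => ?_
  rw [mvHasseDeriv_monomial_sqfree, if_neg (not_le_sqfree_of_two_le hv _)]

/-- Iterated partials with a repeated variable kill the permutation sum (tree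
`iterPDeriv_permSum_eq_zero`). [cite: AndrewsForbes2022, §5] -/
theorem iterPDeriv_permSum_eq_zero_of_not_nodup (c : Equiv.Perm (Fin n) → K)
    {l : List (Fin n × Fin n)} (hl : ¬ l.Nodup) : iterPDeriv l (permSum c) = 0 :=
  iterPDeriv_permSum_eq_zero c l fun _ h => hl h.1

/-- There are no `k`-subsets of `[n]` for `k > n`: the index set of canonical derivatives of order
`k > n` is empty. [cite: AndrewsForbes2022, §5 (proof)] -/
theorem isEmpty_pairIdx_of_lt {k : ℕ} (hk : n < k) : IsEmpty (PairIdx n k) := by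
  refine ⟨fun AB => ?_⟩
  have h := AB.1.2
  have h' := Finset.card_le_univ AB.1.1
  rw [Fintype.card_fin, h] at h'
  omega

/-- Canonical derivatives of one order lie in the span of all of them (orders `k ≤ n`; for `k > n` there
are none). [cite: AndrewsForbes2022, §5] -/
theorem span_range_gen_le_span_allGen (c : Equiv.Perm (Fin n) → K) (k : ℕ) :
    Submodule.span K (Set.range (gen (k := k) c)) ≤
      Submodule.span K (Set.range (fun p : Σ k : Fin (n + 1), PairIdx n k => gen c p.2)) := by
  rcases Nat.lt_or_ge n k with hk | hk
  · haveI := isEmpty_pairIdx_of_lt hk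
    rw [Set.range_eq_empty, Submodule.span_empty]
    exact bot_le
  · refine Submodule.span_mono ?_
    rintro _ ⟨AB, rfl⟩
    exact ⟨⟨⟨k, Nat.lt_succ_of_le hk⟩, AB⟩, rfl⟩

/-- **`∂_{<∞}(permSum) = span of all canonical derivatives`:** every Hasse derivative of the permutation
sum is an iterated partial derivative (or `0`), hence a multiple of a canonical derivative (tree
`iterPDeriv_permSum_mem_span`), and every canonical derivative is a Hasse derivative along distinct
variables (tree `gen_mem_derivSet`). Multiplicative coefficients `c` (determinant, permanent).
[cite: AndrewsForbes2022, §5] -/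
theorem partialSpace_permSum_eq_span (c : Equiv.Perm (Fin n) → K) (hc : ∀ π τ, c (π * τ) = c π * c τ) :
    partialSpace (permSum c) =
      Submodule.span K (Set.range (fun p : Σ k : Fin (n + 1), PairIdx n k => gen c p.2)) := by
  classical
  refine le_antisymm (Submodule.span_le.2 ?_) (Submodule.span_le.2 ?_)
  · rintro _ ⟨a, rfl⟩
    by_cases h1 : ∀ v, a v ≤ 1
    · set A := a.support with hA
      have ha : a = sqfree A := eq_sqfree_support_of_forall_le_one h1
      have hl : sqfree (A.toList).toFinset = a := by rw [Finset.toList_toFinset, ← ha]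
      have hmem := iterPDeriv_permSum_mem_span c hc A.toList (Finset.length_toList A)
      rw [← mvHasseDeriv_permSum_of_nodup c _ (Finset.nodup_toList A), hl] at hmem
      exact span_range_gen_le_span_allGen c A.card hmem
    · push Not at h1
      obtain ⟨v, hv⟩ := h1
      change mvHasseDeriv a (permSum c) ∈ _
      rw [mvHasseDeriv_permSum_eq_zero c hv]
      exact Submodule.zero_mem _
  · rintro _ ⟨⟨k, AB⟩, rfl⟩
    obtain ⟨l, -, hgen⟩ := gen_mem_derivSet c AB
    dsimp only
    rw [hgen]
    by_cases hnd : l.Nodup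
    · rw [← mvHasseDeriv_permSum_of_nodup c l hnd]
      exact Submodule.subset_span ⟨_, rfl⟩
    · rw [iterPDeriv_permSum_eq_zero_of_not_nodup c hnd]
      exact Submodule.zero_mem _

/-- The off-graph of `π` over `B` has `n - |B|` entries. [cite: AndrewsForbes2022, §5 (proof)] -/
theorem card_offGraph (π : Equiv.Perm (Fin n)) (B : Finset (Fin n)) :
    (offGraph π B).card = n - B.card := by
  rw [offGraph, Finset.card_map, Finset.card_compl, Fintype.card_fin]

/-- Canonical derivatives of DIFFERENT orders have disjoint supports: the leading monomial of one of
order `|B|` does not occur in any of order `k' ≠ |B|`. [cite: AndrewsForbes2022, §5] -/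
theorem coeff_gen_eq_zero_of_card_ne (c : Equiv.Perm (Fin n) → K) {k' : ℕ} (π₀ : Equiv.Perm (Fin n))
    (B : Finset (Fin n)) (AB' : PairIdx n k') (hk : B.card ≠ k') :
    coeff (sqfree (offGraph π₀ B)) (gen c AB') = 0 := by
  classical
  rw [gen, canon, coeff_sum]
  refine Finset.sum_eq_zero fun π _ => ?_
  rw [coeff_monomial, if_neg]
  intro h
  have hB : AB'.2.1 = B := eq_of_offGraph_eq_offGraph (sqfree_injective h)
  exact hk (by rw [← hB]; exact AB'.2.2)

/-- **All canonical derivatives together are linearly independent** (nonvanishing coefficients `c`):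
within one order by the tree's `coeff_gen_of_ne`, across orders by `coeff_gen_eq_zero_of_card_ne`.
[cite: AndrewsForbes2022, §5] -/
theorem linearIndependent_allGen (c : Equiv.Perm (Fin n) → K) (hc0 : ∀ π, c π ≠ 0) :
    LinearIndependent K (fun p : Σ k : Fin (n + 1), PairIdx n k => gen c p.2) := by
  classical
  rw [linearIndependent_iff']
  intro s g hsum p₀ hp₀
  obtain ⟨k, AB⟩ := p₀
  have h := congrArg (coeff (sqfree (offGraph (reprPerm AB) AB.2.1))) hsum
  rw [coeff_sum, coeff_zero, Finset.sum_eq_single_of_mem _ hp₀] at h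
  · dsimp only at h
    rw [coeff_smul, gen, coeff_canon_self, smul_eq_mul] at h
    exact (mul_eq_zero.1 h).resolve_right (hc0 _)
  · rintro ⟨k', AB'⟩ _ hne
    dsimp only
    rw [coeff_smul]
    by_cases hk : k' = k
    · subst hk
      have hne' : AB ≠ AB' := fun h' => hne (by rw [h'])
      rw [coeff_gen_of_ne c hne', smul_zero]
    · rw [coeff_gen_eq_zero_of_card_ne c (reprPerm AB) AB.2.1 AB' ?_, smul_zero]
      rw [AB.2.2]
      exact fun h' => hk (Fin.ext h'.symm)

/-- **`dim ∂_{<∞}` of a permutation sum with multiplicative nonvanishing coefficients is `binom(2n, n)`**: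
`∑_{k=0}^{n} binom(n,k)² = binom(2n,n)` canonical derivatives (Mathlib `Nat.sum_range_choose_sq`).
[cite: AndrewsForbes2022, Thm. 5.4 and §5 (p. 29)] -/
theorem finrank_partialSpace_permSum (c : Equiv.Perm (Fin n) → K)
    (hc : ∀ π τ, c (π * τ) = c π * c τ) (hc0 : ∀ π, c π ≠ 0) :
    Module.finrank K (partialSpace (permSum c)) = (2 * n).choose n := by
  rw [partialSpace_permSum_eq_span c hc, finrank_span_eq_card (linearIndependent_allGen c hc0),
    Fintype.card_sigma]
  simp_rw [Fintype.card_prod, Fintype.card_finset_len, Fintype.card_fin]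
  rw [Fin.sum_univ_eq_sum_range (fun k => n.choose k * n.choose k) (n + 1),
    ← Nat.sum_range_choose_sq]
  exact Finset.sum_congr rfl fun k _ => (sq _).symm

variable (K) in
/-- **`dim ∂_{<∞}(det_n) = binom(2n, n)`** over any field (the partials of all orders of the determinant
span the minors of all sizes). [cite: AndrewsForbes2022, Thm. 5.4 and §5 (p. 29)] -/
theorem finrank_partialSpace_detPoly (n : ℕ) :
    Module.finrank K (partialSpace (detPoly (Fin n) K)) = (2 * n).choose n := by
  rw [detPoly_eq_permSum]
  refine finrank_partialSpace_permSum _ (fun π τ => ?_) (fun π => ?_)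
  · rw [Equiv.Perm.sign_mul, Units.val_mul, Int.cast_mul]
  · rcases Int.units_eq_one_or (Equiv.Perm.sign π) with h | h <;> simp [h]

variable (K) in
/-- The same count for the permanent: `dim ∂_{<∞}(perm_n) = binom(2n, n)` over any field (sub-permanents
of all sizes). [cite: AndrewsForbes2022, §5 (p. 29)] -/
theorem finrank_partialSpace_perPoly (n : ℕ) :
    Module.finrank K (partialSpace (perPoly (Fin n) K)) = (2 * n).choose n := by
  rw [perPoly_eq_permSum]
  exact finrank_partialSpace_permSum _ (fun _ _ => (mul_one _).symm) (fun _ => one_ne_zero)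

end PermSum

/-! ## Injective renaming of variables; every `r × r` minor of the generic matrix -/

section Rename

variable {R : Type*} [CommSemiring R] {σ τ : Type*}

/-- Truncated subtraction of exponent vectors commutes with injective renaming.
[cite: AndrewsForbes2022, Lemma 2.14 (proof)] -/
theorem mapDomain_tsub_of_injective {φ : σ → τ} (hφ : Function.Injective φ) (b a : σ →₀ ℕ) :
    Finsupp.mapDomain φ (b - a) = Finsupp.mapDomain φ b - Finsupp.mapDomain φ a := by
  ext t
  rw [Finsupp.tsub_apply]
  by_cases ht : t ∈ Set.range φ
  · obtain ⟨i, rfl⟩ := ht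
    rw [Finsupp.mapDomain_apply hφ, Finsupp.mapDomain_apply hφ, Finsupp.mapDomain_apply hφ,
      Finsupp.tsub_apply]
  · rw [Finsupp.mapDomain_notin_range _ _ ht, Finsupp.mapDomain_notin_range _ _ ht,
      Finsupp.mapDomain_notin_range _ _ ht, tsub_zero]

/-- **Hasse derivatives commute with injective renaming of the variables** (Lemma 2.14 termwise: the
binomial weights and exponents are carried along `φ`). [cite: AndrewsForbes2022, Lemma 2.14] -/
theorem mvHasseDeriv_mapDomain_rename {φ : σ → τ} (hφ : Function.Injective φ) (a : σ →₀ ℕ)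
    (f : MvPolynomial σ R) :
    mvHasseDeriv (Finsupp.mapDomain φ a) (rename φ f) = rename φ (mvHasseDeriv a f) := by
  classical
  rw [f.as_sum, map_sum, mvHasseDeriv_sum, mvHasseDeriv_sum, map_sum]
  refine Finset.sum_congr rfl fun b _ => ?_
  rw [rename_monomial, mvHasseDeriv_monomial, mvHasseDeriv_monomial, rename_monomial,
    ← mapDomain_tsub_of_injective hφ, Finsupp.prod_mapDomain_index_inj hφ]
  simp_rw [Finsupp.mapDomain_apply hφ]

/-- A Hasse derivative involving a variable outside the range of the renaming kills the renamed
polynomial (the weight `binom(0, k) = 0`). [cite: AndrewsForbes2022, Lemma 2.14] -/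
theorem mvHasseDeriv_rename_eq_zero (φ : σ → τ) {a : τ →₀ ℕ} (ha : ¬ (↑a.support ⊆ Set.range φ))
    (f : MvPolynomial σ R) : mvHasseDeriv a (rename φ f) = 0 := by
  classical
  rw [Set.not_subset] at ha
  obtain ⟨t, ht, htφ⟩ := ha
  rw [f.as_sum, map_sum, mvHasseDeriv_sum]
  refine Finset.sum_eq_zero fun b _ => ?_
  rw [rename_monomial, mvHasseDeriv_monomial, prod_choose_eq_zero_of_not_le, zero_mul, map_zero]
  intro hle
  have h1 := Finsupp.le_def.1 hle t
  rw [Finsupp.mapDomain_notin_range _ _ htφ, Nat.le_zero] at h1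
  exact (Finsupp.mem_support_iff.1 (Finset.mem_coe.1 ht)) h1

variable {F : Type*} [Field F]

/-- **`∂_{<∞}(f(φ x)) = (∂_{<∞} f)(φ x)` for an injective renaming `φ`** (the permutation-matrix case of
Lemma 2.20). [cite: AndrewsForbes2022, Lemma 2.20 (injective renaming case)] -/
theorem partialSpace_rename {φ : σ → τ} (hφ : Function.Injective φ) (f : MvPolynomial σ F) :
    partialSpace (rename φ f) =
      (partialSpace f).map (rename φ : MvPolynomial σ F →ₐ[F] MvPolynomial τ F).toLinearMap := by
  classical
  refine le_antisymm (Submodule.span_le.2 ?_) ?_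
  · rintro _ ⟨a, rfl⟩
    change mvHasseDeriv a (rename φ f) ∈ _
    by_cases ha : (↑a.support ⊆ Set.range φ)
    · rw [← Finsupp.mapDomain_comapDomain φ hφ a ha, mvHasseDeriv_mapDomain_rename hφ]
      exact Submodule.mem_map_of_mem (Submodule.subset_span ⟨_, rfl⟩)
    · rw [mvHasseDeriv_rename_eq_zero φ ha f]
      exact Submodule.zero_mem _
  · rw [partialSpace, Submodule.map_span, Submodule.span_le]
    rintro _ ⟨_, ⟨a, rfl⟩, rfl⟩
    change rename φ (mvHasseDeriv a f) ∈ partialSpace (rename φ f)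
    rw [← mvHasseDeriv_mapDomain_rename hφ]
    exact Submodule.subset_span ⟨_, rfl⟩

/-- Injective renaming preserves `dim ∂_{<∞}` (Lemma 2.20, equality case, for renamings).
[cite: AndrewsForbes2022, Lemma 2.20 (injective renaming case)] -/
theorem finrank_partialSpace_rename {φ : σ → τ} (hφ : Function.Injective φ) (f : MvPolynomial σ F) :
    Module.finrank F (partialSpace (rename φ f)) = Module.finrank F (partialSpace f) := by
  rw [partialSpace_rename hφ]
  exact (LinearEquiv.finrank_eq
    (Submodule.equivMapOfInjective _ (fun x y h => rename_injective φ hφ h) _)).symm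

/-- An `r × r` minor of the generic `n × m` matrix `X` (rows `ρ`, columns `γ`) is the generic `r × r`
determinant with its variables renamed along `(i, j) ↦ (ρ i, γ j)`. [cite: AndrewsForbes2022, §5 (p. 29)] -/
theorem det_submatrix_mvPolynomialX {n m r : ℕ} (ρ : Fin r → Fin n) (γ : Fin r → Fin m) :
    ((Matrix.mvPolynomialX (Fin n) (Fin m) F).submatrix ρ γ).det =
      rename (fun p : Fin r × Fin r => (ρ p.1, γ p.2)) (detPoly (Fin r) F) := by
  rw [detPoly, AlgHom.map_det]
  congr 1
  ext i j : 1
  simp [Matrix.mvPolynomialX_apply, rename_X]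

/-- **`dim ∂_{<∞}` of every `r × r` minor of the generic matrix is `binom(2r, r)`** (injective row and
column selections): the instance behind "we clearly have `dim ∂_{<∞}(I^det_{n,m,r}) ≤ binom(2r,r)`"
(p. 29) and the one-row case of Prop. 5.3 with equality; cf. the tree's conditional
`choose_le_finrank_partialSpace_minor`. [cite: AndrewsForbes2022, §5 (p. 29) and Prop. 5.3] -/
theorem finrank_partialSpace_minor {n m r : ℕ} {ρ : Fin r → Fin n} {γ : Fin r → Fin m}
    (hρ : Function.Injective ρ) (hγ : Function.Injective γ) :
    Module.finrank F (partialSpace ((Matrix.mvPolynomialX (Fin n) (Fin m) F).submatrix ρ γ).det) =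
      (2 * r).choose r := by
  rw [det_submatrix_mvPolynomialX, finrank_partialSpace_rename, finrank_partialSpace_detPoly]
  intro p q h
  rw [Prod.mk.injEq] at h
  exact Prod.ext (hρ h.1) (hγ h.2)

end Rename

/-- **Discharge of `AndrewsForbes2022_dim_partialSpace_det`** (AF22 Thm. 5.4 / §5, p. 29:
`dim ∂_{<∞}(det_r) = binom(2r, r)`). [cite: AndrewsForbes2022, Thm. 5.4 and §5 (p. 29)] -/
theorem AndrewsForbes2022_dim_partialSpace_det_holds : AndrewsForbes2022_dim_partialSpace_det :=
  fun F _ r => finrank_partialSpace_detPoly F r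

end Literature.Computability.AlgebraicComplexity
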